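import Mathlib.Analysis.SpecialFunctions.Pow.Real
import Literature.Computability.Complexity.CircuitClassesProofs
import Literature.Computability.MetaComplexity.BranchingPrograms
import Literature.Computability.MetaComplexity.ChenJinWilliams2019.SparseFormulaMagnification
import Literature.Computability.MetaComplexity.ChenJinWilliams2019.SparseMagnificationConverse
import Literature.Computability.MetaComplexity.OliveiraPichSanthanam2019.GapMKtPFormulaBPJuntaBounds
import HarnessLib

/-!
# Chen–Jin–Williams 2019, Theorem 1.1, converse of item 5 (`C = NP`, branching programs) — proved

Discharge (D-0014) of the vendored named fact
`Literature.Computability.MetaComplexity.ChenJinWilliams2019.thm11_item5_NP_converse`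
(`SparseFormulaMagnification.lean`): `NPNotInFixedPolyBP → ∃ ε > 0, SparseNPBPHardAt ε`, i.e. if
for every `k` some `NP` language is outside `BPSIZEae (n ↦ n^k)`, then for every `β ∈ (0,1)` some
`2^{n^β}`-sparse `NP` language is outside `BPSIZEae (n ↦ ⌈n^{2+ε}⌉)` (here with `ε = 1`).

Printed proof (L. Chen, C. Jin, R. R. Williams, *Hardness Magnification for all Sparse NP
Languages*, FOCS 2019; full version ECCC TR19-118, §4.1 p. 14, verbatim): *"The ⇐ direction can be
proved by a simple padding argument. Set `ε = 1`. For every `β ∈ (0, 1)`, by assumption, there is a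
language `L_β ∈ NP` without `n^{2/β}` size circuits. Then we can define another language `L'_β ∈ NP`
as `{x10^{|x|^{1/β}−|x|−1} | x ∈ L_β}`. Clearly, `L'_β` does not have `n^{1+ε} = n²` size
circuits, and it is a `2^{n^β}`-sparse language. This padding argument also works for other
computational models (except the last two items in the theorem statement)."*

## The formal proof (same argument, tree vocabulary)

This is the branching-program replica of the tree's proof of the item-1 (circuit) converse,
`SparseMagnificationConverse.lean` (`thm11_circuit_NP_converse_holds`): the padded language is the
same image `polyPad q '' L = {⟨x, 1^{|x|^q}⟩ | x ∈ L}` (`q = ⌈1/β⌉`, pair code `boolPair`,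
`|polyPad q x| = 2|x| + 2 + |x|^q`), so its `NP` membership (`image_polyPad_mem_NP`) and its
`2^{n^β}`-sparsity (`isSparse_image_polyPad`) are imported verbatim. Only the hardness transfer
changes model:

* **Restriction of a branching program along the pad** (`BranchingProgram.exists_restrict`): a
  program on the `N = 2n + 2 + n^q` pad positions becomes a program on the `n` payload positions of
  the SAME size — a node querying a doubled payload position `2i` or `2i+1` queries `x_i`; a node
  querying a constant position (separator `01`, pad `1^{n^q}`) keeps a dummy variable and sends BOTH
  edges to the successor selected by that constant (Wegener 2000, Def. 1.1.1: the computation path;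
  the restricted program follows the path of the padded input).
* Hence `polyPad q '' L ∈ BPSIZEae (N ↦ N³)` gives `L ∈ BPSIZEae (n ↦ n^{3q+1})`
  (`(2n + 2 + n^q)³ ≤ 125·n^{3q} ≤ n^{3q+1}` for `n ≥ 125`), contradicting the choice of `L` by
  `NPNotInFixedPolyBP` at `k = 3q + 1`.

Main results: `sparseNPBPHardAt_one_of_NPNotInFixedPolyBP` (the quantitative form, `ε = 1`),
`thm11_item5_NP_converse_holds : thm11_item5_NP_converse`, and the hypothesis-reduced
equivalence `sparseNPBPHard_iff_of_thm11_item5` (only the magnification direction `thm11_item5_NP`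
remains a named fact).

## References

* L. Chen, C. Jin, R. R. Williams, *Hardness Magnification for all Sparse NP Languages*, FOCS 2019,
  1240–1255; ECCC TR19-118, Thm. 1.1 and §4.1 (p. 14, "The ⇐ direction … This padding argument
  also works for other computational models"). [bib: ChenJinWilliams2019]
* I. Wegener, *Branching Programs and Binary Decision Diagrams*, SIAM 2000, Def. 1.1.1 (branching
  programs, computation path, size; replacement of variables by constants). [bib: Wegener2000]
* S. Arora, B. Barak, *Computational Complexity: A Modern Approach*, CUP 2009, §0.1 (pairing of
  strings), §2.6.2 (padding). [bib: AroraBarakCC2009]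
-/

noncomputable section

namespace Literature.Computability.MetaComplexity

open Literature.Computability.Complexity

/-! ### Restricting a branching program along a wiring by variables and constants -/

namespace BranchingProgram

variable {N n : ℕ}

/-- **Restriction of a branching program** (Wegener 2000, Def. 1.1.1: the computation path, and
the replacement of variables by constants and variables). Given a program `P` on `N` variables and a
wiring `ρ` sending each of the `N` positions to a variable among `n` ones or to a constant, there is
a program on `n` variables OF THE SAME SIZE computing `u ↦ P(ρ^*u)`, `(ρ^*u)_j = u_i` if
`ρ j = xᵢ`, `= b` if `ρ j = b`: every node keeps its rank and successors, queries `xᵢ` if its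
position is wired to `xᵢ`, and otherwise queries the dummy variable `x_{i₀}` with BOTH outgoing
edges redirected to the successor selected by the constant. [cite: Wegener2000, Def. 1.1.1] -/
theorem exists_restrict (P : BranchingProgram N) (ρ : Fin N → Fin n ⊕ Bool) (i₀ : Fin n) :
    ∃ Q : BranchingProgram n, Q.size = P.size ∧
      ∀ u : Fin n → Bool, Q.eval u = P.eval fun j => Sum.elim u id (ρ j) := by
  let Q : BranchingProgram n :=
    { m := P.m
      var := fun v => Sum.elim id (fun _ => i₀) (ρ (P.var v))
      next := fun v b => P.next v (Sum.elim (fun _ => b) id (ρ (P.var v)))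
      start := P.start
      rank := P.rank
      rank_lt := fun v b w h => P.rank_lt v _ w h }
  refine ⟨Q, rfl, fun u => ?_⟩
  -- one step of the computation path agrees
  have step : ∀ v : Fin P.m,
      Q.next v (u (Q.var v)) = P.next v (Sum.elim u id (ρ (P.var v))) := by
    intro v
    show P.next v (Sum.elim (fun _ => u (Sum.elim id (fun _ => i₀) (ρ (P.var v)))) id
        (ρ (P.var v))) = P.next v (Sum.elim u id (ρ (P.var v)))
    generalize ρ (P.var v) = r
    cases r <;> rfl
  -- hence the whole path agrees, for every fuel
  have key : ∀ (fuel : ℕ) (s : Fin P.m ⊕ Bool),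
      Q.evalFrom u fuel s = P.evalFrom (fun j => Sum.elim u id (ρ j)) fuel s := by
    intro fuel
    induction fuel with
    | zero => intro s; cases s <;> rfl
    | succ fuel ih =>
      intro s
      cases s with
      | inr b => rfl
      | inl v =>
        show Q.evalFrom u fuel (Q.next v (u (Q.var v))) =
          P.evalFrom (fun j => Sum.elim u id (ρ j)) fuel (P.next v (Sum.elim u id (ρ (P.var v))))
        rw [step v]
        exact ih _
  have hfuel : Q.fuelOf Q.start = P.fuelOf P.start := by
    show Q.fuelOf P.start = P.fuelOf P.start
    cases P.start <;> rfl
  show Q.evalFrom u (Q.fuelOf Q.start) Q.start = P.evalFrom _ (P.fuelOf P.start) P.start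
  rw [hfuel]
  exact key _ _

/-- **Restriction along the pad `⟨u, 1^m⟩`** (the instance used by the padding argument): a
program on the `2n + 2 + m` bits of `pairVec u 1^m` — the bits of `u` doubled, the separator `01`,
then `m` ones (Arora–Barak 2009, §0.1) — restricts, for `n ≥ 1`, to a program on the `n` bits of
`u` of the same size computing `u ↦ P(pairVec u 1^m)`.
[cite: ChenJinWilliams2019, Thm. 1.1 (converse), TR19-118 §4.1 p. 14] -/
theorem exists_restrict_pairVec {m : ℕ} (P : BranchingProgram (2 * n + 2 + m)) (hn : 0 < n) :
    ∃ Q : BranchingProgram n, Q.size = P.size ∧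
      ∀ u : Fin n → Bool, Q.eval u = P.eval (pairVec u fun _ : Fin m => true) := by
  -- the wiring of the pad: doubled payload positions to variables, the rest to constants
  let ρ : Fin (2 * n + 2 + m) → Fin n ⊕ Bool :=
    Fin.append (Fin.append
      (fun i : Fin (2 * n) => (Sum.inl ⟨(i : ℕ) / 2, by have := i.2; omega⟩ : Fin n ⊕ Bool))
      (fun t : Fin 2 => Sum.inr (![false, true] t)))
      (fun _ : Fin m => Sum.inr true)
  obtain ⟨Q, hQs, hQe⟩ := P.exists_restrict ρ ⟨0, hn⟩
  refine ⟨Q, hQs, fun u => ?_⟩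
  have hρ : (fun j => Sum.elim u id (ρ j)) = pairVec u fun _ : Fin m => true := by
    funext j
    refine Fin.addCases (fun k => ?_) (fun l => ?_) j
    · refine Fin.addCases (fun i => ?_) (fun t => ?_) k
      · simp only [ρ, pairVec, Fin.append_left, Sum.elim_inl]
      · simp only [ρ, pairVec, Fin.append_left, Fin.append_right, Sum.elim_inr, id]
    · simp only [ρ, pairVec, Fin.append_right, Sum.elim_inr, id]
  rw [hQe u, hρ]

end BranchingProgram

namespace ChenJinWilliams2019

open Literature.Computability.Complexity.Nondeterministic Literature.Computability.Complexity.Brick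

/-! ### The padded language `polyPad q '' L` (as in the circuit file) -/

/-- A pad lies in the padded language iff its payload lies in `L` (`polyPad q` is injective: its
first component is the payload). [folklore] -/
private theorem polyPad_mem_image_iff {q : ℕ} {L : Language Bool} {x : List Bool} :
    polyPad q x ∈ polyPad q '' L ↔ x ∈ L :=
  (show Function.Injective (polyPad q) from fun x y h => by simpa using congrArg fstF h).mem_set_image

/-- The indicator of the padded language at a pad is the indicator of `L` at the payload.
[folklore] -/
private theorem boolIndicator_image_polyPad (q : ℕ) (L : Language Bool) (x : List Bool) :
    (polyPad q '' L).boolIndicator (polyPad q x) = (L : Set (List Bool)).boolIndicator x := by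
  by_cases hx : x ∈ L
  · rw [((polyPad q '' L).mem_iff_boolIndicator _).1 (polyPad_mem_image_iff.2 hx),
      ((L : Set (List Bool)).mem_iff_boolIndicator _).1 hx]
  · rw [((polyPad q '' L).notMem_iff_boolIndicator _).1
        (fun h => hx (polyPad_mem_image_iff.1 h)),
      ((L : Set (List Bool)).notMem_iff_boolIndicator _).1 hx]

/-! ### Hardness transfer (print: "This padding argument also works for other computational models") -/

/-- `⌈N^{2+1}⌉ = N³`. [folklore] -/
private theorem powCeil_two_add_one (N : ℕ) : powCeil (2 + 1) N = N ^ 3 := by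
  unfold powCeil
  rw [show (2 : ℝ) + 1 = ((3 : ℕ) : ℝ) by norm_num, Real.rpow_natCast, ← Nat.cast_pow,
    Nat.ceil_natCast]

/-- Size bookkeeping of the transfer: for `1 ≤ q` and `n ≥ 125`,
`(2n + 2 + n^q)³ ≤ 125·n^{3q} ≤ n^{3q+1}`. [folklore] -/
private theorem padLength_pow_three_le {q : ℕ} (hq : 1 ≤ q) {n : ℕ} (hn : 125 ≤ n) :
    (2 * n + 2 + n ^ q) ^ 3 ≤ n ^ (3 * q + 1) := by
  have hnq : n ≤ n ^ q := Nat.le_self_pow (by omega) n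
  have h5 : 2 * n + 2 + n ^ q ≤ 5 * n ^ q := by omega
  calc (2 * n + 2 + n ^ q) ^ 3 ≤ (5 * n ^ q) ^ 3 := Nat.pow_le_pow_left h5 3
    _ = 125 * n ^ (3 * q) := by ring
    _ ≤ n * n ^ (3 * q) := Nat.mul_le_mul_right _ hn
    _ = n ^ (3 * q + 1) := by ring

/-- **Hardness transfer by padding, branching programs.** If the padded language `polyPad q '' L`
(`1 ≤ q`) has branching programs of size `≤ ⌈N^{2+1}⌉ = N³` at every large length `N`, then `L`
has branching programs of size `≤ n^{3q+1}` at every large length `n`: at length `n ≥ 1`, restrict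
the program for length `N = 2n + 2 + n^q` along the pad `u ↦ ⟨u, 1^{n^q}⟩`
(`BranchingProgram.exists_restrict_pairVec`, same size); at length `0` use a constant sink.
[cite: ChenJinWilliams2019, Thm. 1.1 (converse of item 5), TR19-118 §4.1 p. 14] -/
theorem mem_BPSIZEae_of_image_polyPad_mem_BPSIZEae {q : ℕ} (hq : 1 ≤ q) {L : Language Bool}
    (h : polyPad q '' L ∈ BPSIZEae (powCeil (2 + 1))) :
    L ∈ BPSIZEae fun n => n ^ (3 * q + 1) := by
  obtain ⟨P, ⟨N₀, hN₀⟩, hdec⟩ := h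
  have main : ∀ n : ℕ, ∃ Q : BranchingProgram n, Q.size ≤ (P (2 * n + 2 + n ^ q)).size ∧
      ∀ u : Fin n → Bool, Q.eval u = (L : Set (List Bool)).boolIndicator (List.ofFn u) := by
    intro n
    rcases Nat.eq_zero_or_pos n with rfl | hn
    · refine ⟨BranchingProgram.const 0 ((L : Set (List Bool)).boolIndicator []), Nat.zero_le _,
        fun u => ?_⟩
      rw [BranchingProgram.eval_const, List.ofFn_zero]
    · obtain ⟨Q, hQs, hQe⟩ := (P (2 * n + 2 + n ^ q)).exists_restrict_pairVec hn
      refine ⟨Q, hQs.le, fun u => ?_⟩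
      rw [hQe u, hdec.eval_ofFn, ofFn_pairVec, List.ofFn_const]
      have hpad : boolPair (List.ofFn u) (List.replicate (n ^ q) true) =
          polyPad q (List.ofFn u) := by
        rw [polyPad, List.length_ofFn]
      rw [hpad, boolIndicator_image_polyPad]
  choose Q hQ using main
  refine ⟨Q, ⟨max N₀ 125, fun n hn => ?_⟩, fun x => ?_⟩
  · have hn125 : 125 ≤ n := le_of_max_le_right hn
    have hN : N₀ ≤ 2 * n + 2 + n ^ q := (le_of_max_le_left hn).trans (by omega)
    calc (Q n).size ≤ (P (2 * n + 2 + n ^ q)).size := (hQ n).1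
      _ ≤ powCeil (2 + 1) (2 * n + 2 + n ^ q) := hN₀ _ hN
      _ = (2 * n + 2 + n ^ q) ^ 3 := powCeil_two_add_one _
      _ ≤ n ^ (3 * q + 1) := padLength_pow_three_le hq hn125
  · have := (hQ x.length).2 x.get
    rwa [List.ofFn_get] at this

/-! ### The named fact -/

/-- **Chen–Jin–Williams 2019, Thm. 1.1, converse of item 5 (`C = NP`), quantitative form with
`ε = 1`:** if for every `k` some `NP` language is outside `BPSIZEae (n ↦ n^k)`, then for every
`β ∈ (0,1)` some `2^{n^β}`-sparse `NP` language is outside `BPSIZEae (n ↦ ⌈n^{2+1}⌉)` — namely the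
pad `{⟨x, 1^{|x|^q}⟩ | x ∈ L}`, `q = ⌈1/β⌉`, of an `NP` language `L ∉ BPSIZEae (n ↦ n^{3q+1})`.
Printed: TR19-118 §4.1 p. 14, "The ⇐ direction can be proved by a simple padding argument. Set
`ε = 1`. … This padding argument also works for other computational models".
[cite: ChenJinWilliams2019, Thm. 1.1 (converse of item 5), TR19-118 §4.1 p. 14] -/
theorem sparseNPBPHardAt_one_of_NPNotInFixedPolyBP (h : NPNotInFixedPolyBP) :
    SparseNPBPHardAt 1 := by
  intro β hβ0 _hβ1
  have hq : 1 ≤ ⌈1 / β⌉₊ := Nat.ceil_pos.2 (by positivity)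
  have hqβ : 1 ≤ (⌈1 / β⌉₊ : ℝ) * β := by
    have h1 : 1 / β ≤ (⌈1 / β⌉₊ : ℝ) := Nat.le_ceil (1 / β)
    calc (1 : ℝ) = 1 / β * β := by field_simp
      _ ≤ (⌈1 / β⌉₊ : ℝ) * β := mul_le_mul_of_nonneg_right h1 hβ0.le
  obtain ⟨L, hL, hhard⟩ := h (3 * ⌈1 / β⌉₊ + 1)
  exact ⟨polyPad ⌈1 / β⌉₊ '' L, image_polyPad_mem_NP _ hL, isSparse_image_polyPad hβ0 hqβ L,
    fun hc => hhard (mem_BPSIZEae_of_image_polyPad_mem_BPSIZEae hq hc)⟩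

/-- **Discharge of the named fact `thm11_item5_NP_converse`** (Chen–Jin–Williams 2019, Thm. 1.1,
"Moreover, the converse of each item above also holds", item 5, `C = NP`):
`NPNotInFixedPolyBP → ∃ ε > 0, SparseNPBPHardAt ε`, with `ε = 1`.
[cite: ChenJinWilliams2019, Thm. 1.1 (converse of item 5), TR19-118 pp. 4, 14] -/
theorem thm11_item5_NP_converse_holds : thm11_item5_NP_converse :=
  fun h => ⟨1, one_pos, sparseNPBPHardAt_one_of_NPNotInFixedPolyBP h⟩

/-- Every `ε ∈ [0,1]` works in the converse (antitonicity of `SparseNPBPHardAt` in `ε`).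
[cite: ChenJinWilliams2019, Thm. 1.1 (converse of item 5), TR19-118 §4.1 p. 14] -/
theorem sparseNPBPHardAt_of_NPNotInFixedPolyBP (h : NPNotInFixedPolyBP) {ε : ℝ} (hε0 : 0 ≤ ε)
    (hε1 : ε ≤ 1) : SparseNPBPHardAt ε :=
  (sparseNPBPHardAt_one_of_NPNotInFixedPolyBP h).anti hε0 hε1

/-- The printed EQUIVALENCE of Thm. 1.1 item 5 (`C = NP`) with only the magnification direction
left as a named-fact hypothesis: the sparse-language branching-program hypothesis (at some `ε > 0`)
holds iff `NP ⊄ BP[n^k] ∀ k` (`sparseNPBPHard_iff` fed with `thm11_item5_NP_converse_holds`).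
[cite: ChenJinWilliams2019, Thm. 1.1 (item 5 and its converse), TR19-118 pp. 3–4, 14] -/
theorem sparseNPBPHard_iff_of_thm11_item5 (h : thm11_item5_NP) :
    (∃ ε : ℝ, 0 < ε ∧ SparseNPBPHardAt ε) ↔ NPNotInFixedPolyBP :=
  sparseNPBPHard_iff h thm11_item5_NP_converse_holds

end ChenJinWilliams2019

end Literature.Computability.MetaComplexity
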